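import Summits.ValiantsHypothesis.ValiantsHypothesis.Theses.TwistedDetRank
import Summits.ValiantsHypothesis.ValiantsHypothesis.Theorems.TwistedDetRankTdrPerNotQP
import Summits.ValiantsHypothesis.ValiantsHypothesis.Theorems.TwistedDetRankFermionicNormalFormSummitHard
import Literature.Computability.AlgebraicComplexity.ArithCircuitProofs

/-!
# Strategist census artefact (crux `FermionicNormalForm`, stmt-ValiantsHypothesis-6283) — §Strengthen

Two kernel-checked facts from LANDED lemmas of route TwistedDetRank (`stub_conePowerRankThree`,
`coneRestriction_sign_blockPerm`, `coneRestriction_prod_blockPerm`, `stub_expBeatsQP`,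
`tdrPerNotQP_qp_transfer`, `repr_of_gmf_eq`):

* `directSumExp_candidate : DirectSumExp` — the OPEN route item stmt-ValiantsHypothesis-6285 is
  provable now: every representation of `per₃ ⊕ ⋯ ⊕ per₃` (`m` blocks) as a sum of `r` twisted
  determinants has `(2:ℝ)^(log₂(3/2) · m) = (3/2)^m ≤ r`.  (CANDIDATE proof for a prover to land under
  `Theorems/`; this seat does not propose.)
* `unrestrictedFNF_false : ¬ UnrestrictedFNF` — the crux WITHOUT its class-function hypothesis is
  FALSE: the block family `n ↦ [3 ∣ n] · Σ_{σ block permutation} X^σ` (product of the permanents of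
  the `n/3` diagonal `3 × 3` blocks; `Π_i X_ii` when `3 ∤ n`) is p-computable (complexity `≤ 9n`) and
  has `tdr ≥ (3/2)^{n/3}` at `n = 3m`.  So any proof of X2 must use the class-function hypothesis
  (a `_false_without_classFunction` fact for the crux's Disproof record).
-/

set_option linter.dupNamespace false

noncomputable section

namespace Summit.ValiantsHypothesis.ValiantsHypothesis.Cruxes.FermionicNormalForm.StrategistStrengthen

open Equiv MvPolynomial Literature.Computability.AlgebraicComplexity
open Summit.ValiantsHypothesis.ValiantsHypothesis.Theses.TwistedDetRank
open Summit.ValiantsHypothesis.ValiantsHypothesis.Theorems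
open Summit.ValiantsHypothesis.ValiantsHypothesis.Theorems.TwistedDetRankTdrPerNotQP
open Summit.ValiantsHypothesis.ValiantsHypothesis.Theorems.TwistedDetRankFermionicNormalForm
open scoped BigOperators

/-! ## §1 Block permutations of `Fin (m·3)` and the block family -/

/-- The block permutation `σ_π` of `Fin (m·3)` attached to `π : Fin m → S_3`. -/
abbrev blockPerm {m : ℕ} (π : Fin m → Perm (Fin 3)) : Perm (Fin (m * 3)) :=
  finProdFinEquiv.permCongr (Equiv.prodCongrRight π)

theorem blockPerm_apply {m : ℕ} (π : Fin m → Perm (Fin 3)) (b : Fin m) (i : Fin 3) :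
    blockPerm π (finProdFinEquiv (b, i)) = finProdFinEquiv (b, π b i) := by
  simp [Equiv.permCongr_apply]

theorem blockPerm_injective (m : ℕ) : Function.Injective (blockPerm (m := m)) := by
  intro π π' h
  funext b
  ext i
  have h1 := congrArg (fun σ : Perm (Fin (m * 3)) => σ (finProdFinEquiv (b, i))) h
  simp only [blockPerm_apply] at h1
  have h2 := finProdFinEquiv.injective h1
  simp only [Prod.mk.injEq, true_and] at h2
  exact_mod_cast congrArg Fin.val h2

/-- Coefficient function of the block family: the indicator of the block permutations. -/
def blockCoeff (m : ℕ) (σ : Perm (Fin (m * 3))) : ℂ :=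
  if σ ∈ Finset.univ.image (blockPerm (m := m)) then 1 else 0

theorem blockCoeff_blockPerm {m : ℕ} (π : Fin m → Perm (Fin 3)) : blockCoeff m (blockPerm π) = 1 := by
  unfold blockCoeff
  rw [if_pos (Finset.mem_image_of_mem _ (Finset.mem_univ π))]

/-- Splitting a product over `Fin (m·3)` at a block permutation into blocks (any commutative monoid;
the landed `coneRestriction_prod_blockPerm` is the case `ℂ`). [folklore] -/
theorem prod_blockPerm {M : Type*} [CommMonoid M] {m : ℕ} (F : Fin (m * 3) → Fin (m * 3) → M)
    (π : Fin m → Perm (Fin 3)) :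
    ∏ j, F (blockPerm π j) j = ∏ b, ∏ i, F (finProdFinEquiv (b, π b i)) (finProdFinEquiv (b, i)) := by
  rw [← finProdFinEquiv.prod_comp, Fintype.prod_prod_type]
  simp only [blockPerm_apply]

/-- **The block family is the product of the block permanents**:
`Σ_σ C(blockCoeff σ) Π_j X(σ j, j) = Π_b Σ_{τ ∈ S_3} Π_i X(e(b, τ i), e(b, i))`, `e = finProdFinEquiv`. [folklore] -/
theorem gmf_blockCoeff_eq_prod (m : ℕ) :
    (∑ σ : Perm (Fin (m * 3)), C (blockCoeff m σ) *
        ∏ j : Fin (m * 3), (X (σ j, j) : MvPolynomial (Fin (m * 3) × Fin (m * 3)) ℂ)) =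
      ∏ b : Fin m, ∑ τ : Perm (Fin 3), ∏ i : Fin 3,
        (X (finProdFinEquiv (b, τ i), finProdFinEquiv (b, i)) :
          MvPolynomial (Fin (m * 3) × Fin (m * 3)) ℂ) := by
  -- right-hand side: product of sums = sum over `π` of block products = sum of monomials of `σ_π`
  rw [Finset.prod_univ_sum]
  simp only [Fintype.piFinset_univ]
  have hR : ∀ π : Fin m → Perm (Fin 3),
      (∏ b, ∏ i, (X (finProdFinEquiv (b, π b i), finProdFinEquiv (b, i)) :
          MvPolynomial (Fin (m * 3) × Fin (m * 3)) ℂ)) =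
        ∏ j, (X (blockPerm π j, j) : MvPolynomial (Fin (m * 3) × Fin (m * 3)) ℂ) := fun π =>
    (prod_blockPerm (fun a c => (X (a, c) : MvPolynomial (Fin (m * 3) × Fin (m * 3)) ℂ)) π).symm
  simp_rw [hR]
  -- left-hand side: the indicator kills everything outside the image, on which the map is injective
  have hL : ∀ σ : Perm (Fin (m * 3)), C (blockCoeff m σ) *
      ∏ j : Fin (m * 3), (X (σ j, j) : MvPolynomial (Fin (m * 3) × Fin (m * 3)) ℂ) =
      if σ ∈ Finset.univ.image (blockPerm (m := m)) then
        ∏ j : Fin (m * 3), (X (σ j, j) : MvPolynomial (Fin (m * 3) × Fin (m * 3)) ℂ) else 0 := by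
    intro σ
    unfold blockCoeff
    split_ifs <;> simp
  simp_rw [hL]
  rw [Finset.sum_ite_mem, Finset.univ_inter,
    Finset.sum_image fun π _ π' _ h => blockPerm_injective m h]

/-- Complexity of the block product: `≤ 25 m` (each block permanent `≤ 24`, one product gate per block). [folklore] -/
theorem complexity_blockProd_le (m : ℕ) :
    complexity (∏ b : Fin m, ∑ τ : Perm (Fin 3), ∏ i : Fin 3,
        (X (finProdFinEquiv (b, τ i), finProdFinEquiv (b, i)) :
          MvPolynomial (Fin (m * 3) × Fin (m * 3)) ℂ)) ≤ 25 * m := by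
  have hblock : ∀ b : Fin m, complexity (∑ τ : Perm (Fin 3), ∏ i : Fin 3,
      (X (finProdFinEquiv (b, τ i), finProdFinEquiv (b, i)) :
        MvPolynomial (Fin (m * 3) × Fin (m * 3)) ℂ)) ≤ 24 := by
    intro b
    have hτ : ∀ τ : Perm (Fin 3), complexity (∏ i : Fin 3,
        (X (finProdFinEquiv (b, τ i), finProdFinEquiv (b, i)) :
          MvPolynomial (Fin (m * 3) × Fin (m * 3)) ℂ)) ≤ 3 := by
      intro τ
      refine (complexity_finset_prod_le _ _).trans ?_
      have hX : ∀ x : Fin (m * 3) × Fin (m * 3),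
          complexity (X x : MvPolynomial (Fin (m * 3) × Fin (m * 3)) ℂ) = 0 := complexity_X_holds
      simp [hX]
    refine (complexity_finset_sum_le _ _).trans ?_
    have hcard : (Finset.univ : Finset (Perm (Fin 3))).card = 6 := by
      rw [Finset.card_univ, Fintype.card_perm, Fintype.card_fin]; rfl
    calc ∑ τ : Perm (Fin 3), complexity (∏ i : Fin 3,
            (X (finProdFinEquiv (b, τ i), finProdFinEquiv (b, i)) :
              MvPolynomial (Fin (m * 3) × Fin (m * 3)) ℂ)) + (Finset.univ : Finset (Perm (Fin 3))).card
        ≤ ∑ _τ : Perm (Fin 3), 3 + (Finset.univ : Finset (Perm (Fin 3))).card :=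
          Nat.add_le_add_right (Finset.sum_le_sum fun τ _ => hτ τ) _
      _ = 24 := by rw [Finset.sum_const, hcard]; rfl
  refine (complexity_finset_prod_le _ _).trans ?_
  calc ∑ b : Fin m, complexity (∑ τ : Perm (Fin 3), ∏ i : Fin 3,
          (X (finProdFinEquiv (b, τ i), finProdFinEquiv (b, i)) :
            MvPolynomial (Fin (m * 3) × Fin (m * 3)) ℂ)) + (Finset.univ : Finset (Fin m)).card
      ≤ ∑ _b : Fin m, 24 + (Finset.univ : Finset (Fin m)).card :=
        Nat.add_le_add_right (Finset.sum_le_sum fun b _ => hblock b) _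
    _ = 25 * m := by rw [Finset.sum_const, Finset.card_univ, Fintype.card_fin]; ring

/-! ## §2 The cone lower bound for the block family (landed `stub_conePowerRankThree`) -/

/-- **Block lower bound.** If the block family on `Fin (m·3)` is a sum of `r` twisted determinants
then `3^m ≤ r · 2^m`: coefficient extraction at the block permutations (`repr_of_gmf_eq`) gives a cone
decomposition of `sgn_3^{⊗m}` (`coneRestriction_sign_blockPerm`, `coneRestriction_prod_blockPerm`), and
`stub_conePowerRankThree` applies. [this census, from landed lemmas] -/
theorem block_lower_bound (m r : ℕ) (E : Fin r → Matrix (Fin (m * 3)) (Fin (m * 3)) ℂ)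
    (h : (∑ σ : Perm (Fin (m * 3)), C (blockCoeff m σ) *
        ∏ j : Fin (m * 3), (X (σ j, j) : MvPolynomial (Fin (m * 3) × Fin (m * 3)) ℂ)) =
      ∑ t, (Matrix.of fun i j => C (E t i j) * X (i, j)).det) :
    3 ^ m ≤ r * 2 ^ m := by
  refine stub_conePowerRankThree m r
    (fun t b i' i => E t (finProdFinEquiv (b, i')) (finProdFinEquiv (b, i))) fun π => ?_
  have hco := repr_of_gmf_eq (blockCoeff m) E h (blockPerm π)
  rw [blockCoeff_blockPerm] at hco
  -- `hco : 1 = Σ_t sgn σ_π · Π_j E t (σ_π j) j`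
  set s : ℂ := ((Perm.sign (blockPerm π) : ℤ) : ℂ) with hs
  have hss : s * s = 1 := TwistedDetRankTdrSuperadditive.sign_mul_sign_self _
  have hsgn : s = ∏ b, ((Perm.sign (π b) : ℤ) : ℂ) := coneRestriction_sign_blockPerm π
  have hprod : ∀ t, ∏ j, E t (blockPerm π j) j =
      ∏ b, ∏ i, E t (finProdFinEquiv (b, π b i)) (finProdFinEquiv (b, i)) := fun t =>
    coneRestriction_prod_blockPerm (E t) π
  calc ∑ t, ∏ b, ∏ i, E t (finProdFinEquiv (b, π b i)) (finProdFinEquiv (b, i))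
      = ∑ t, ∏ j, E t (blockPerm π j) j := Finset.sum_congr rfl fun t _ => (hprod t).symm
    _ = s * s * ∑ t, ∏ j, E t (blockPerm π j) j := by rw [hss, one_mul]
    _ = s * ∑ t, s * ∏ j, E t (blockPerm π j) j := by rw [mul_assoc, Finset.mul_sum]
    _ = s * 1 := by rw [← hco]
    _ = ∏ b, ((Perm.sign (π b) : ℤ) : ℂ) := by rw [mul_one, hsgn]

/-! ## §3 Transport of GMFs and twisted determinants along a relabelling -/

/-- Renaming a twisted determinant along `e × e` is the twisted determinant of the transported twist. [folklore] -/
theorem rename_twistedDet {ι : Type*} [Fintype ι] [DecidableEq ι] {n' : ℕ} (e : ι ≃ Fin n')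
    (N : Matrix ι ι ℂ) :
    rename (Prod.map e e) ((Matrix.of fun p q => C (N p q) * (X (p, q) : MvPolynomial (ι × ι) ℂ)).det) =
      (Matrix.of fun i j => C (N (e.symm i) (e.symm j)) *
        (X (i, j) : MvPolynomial (Fin n' × Fin n') ℂ)).det := by
  rw [show (rename (Prod.map e e) : MvPolynomial (ι × ι) ℂ →ₐ[ℂ] MvPolynomial (Fin n' × Fin n') ℂ)
      ((Matrix.of fun p q => C (N p q) * (X (p, q) : MvPolynomial (ι × ι) ℂ)).det) =
      ((rename (Prod.map e e) : MvPolynomial (ι × ι) ℂ →ₐ[ℂ] _).toRingHom.mapMatrix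
        (Matrix.of fun p q => C (N p q) * (X (p, q) : MvPolynomial (ι × ι) ℂ))).det from
      RingHom.map_det _ _]
  rw [← Matrix.det_submatrix_equiv_self e]
  congr 1
  ext i j
  simp [Matrix.submatrix_apply, rename_X]

/-- Renaming a GMF along `e × e`: the coefficient function is transported by `e.permCongr`. [folklore] -/
theorem rename_gmf {n n' : ℕ} (e : Fin n ≃ Fin n') (g : Perm (Fin n') → ℂ) :
    rename (Prod.map e e) (∑ σ : Perm (Fin n), C (g (e.permCongr σ)) *
        ∏ i : Fin n, (X (σ i, i) : MvPolynomial (Fin n × Fin n) ℂ)) =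
      ∑ σ' : Perm (Fin n'), C (g σ') * ∏ j : Fin n', (X (σ' j, j) : MvPolynomial (Fin n' × Fin n') ℂ) := by
  simp only [map_sum, map_mul, map_prod, rename_C, rename_X, Prod.map_apply]
  refine Fintype.sum_equiv (e.permCongr) _ _ fun σ => ?_
  congr 1
  refine Fintype.prod_equiv e _ _ fun i => ?_
  simp [Equiv.permCongr_apply]

/-! ## §4 DirectSumExp (route item stmt-ValiantsHypothesis-6285) — candidate proof -/

/-- **DirectSumExp holds** with `c = log₂ (3/2)`: every representation of `per₃ ⊕ ⋯ ⊕ per₃` (the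
product of the permanents of the `m` diagonal `3 × 3` blocks of the `(Fin m × Fin 3)`-indexed generic
matrix) as a sum of `r` twisted determinants has `(3/2)^m ≤ r`.  Transport to `Fin (m·3)`
(`rename` along `finProdFinEquiv`), identify with the block family (`gmf_blockCoeff_eq_prod`) and apply
`block_lower_bound`. [this census, from landed lemmas] -/
theorem directSumExp_candidate : DirectSumExp := by
  refine ⟨Real.logb 2 (3 / 2), Real.logb_pos one_lt_two (by norm_num), fun m r E hE => ?_⟩
  -- transport the representation to `Fin (m * 3)`
  have h' := congrArg (rename (Prod.map (finProdFinEquiv (m := m) (n := 3))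
    (finProdFinEquiv (m := m) (n := 3)))) hE
  rw [map_sum] at h'
  simp only [rename_twistedDet] at h'
  rw [map_prod] at h'
  simp only [map_sum, map_prod, rename_X, Prod.map_apply] at h'
  rw [← gmf_blockCoeff_eq_prod] at h'
  have hlb := block_lower_bound m r _ h'
  -- `(3/2)^m ≤ r` as reals
  have h2 : (0 : ℝ) < 2 ^ m := pow_pos two_pos m
  have hreal : (3 : ℝ) ^ m ≤ r * 2 ^ m := by exact_mod_cast hlb
  rw [Real.rpow_mul (by norm_num : (0 : ℝ) ≤ 2), Real.rpow_logb two_pos (by norm_num) (by norm_num),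
    Real.rpow_natCast, div_pow, div_le_iff₀ h2]
  exact hreal

/-! ## §5 The crux without its class-function hypothesis is FALSE -/

/-- X2 with the class-function hypothesis deleted: every p-computable GMF family
`f_n = Σ_σ β_n(σ) Π_i X_{σ(i),i}` (ANY coefficient function `β`) has quasi-polynomial tdr for `n ≥ 1`. -/
def UnrestrictedFNF : Prop :=
  ∀ β : (n : ℕ) → Equiv.Perm (Fin n) → ℂ,
    IsPComputable (fun n => ∑ σ : Equiv.Perm (Fin n), MvPolynomial.C (β n σ) *
      ∏ i : Fin n, (MvPolynomial.X (σ i, i) : MvPolynomial (Fin n × Fin n) ℂ)) →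
    ∃ c : ℕ, ∀ n : ℕ, 1 ≤ n → ∃ r ≤ 2 ^ ((Nat.log 2 n + c) ^ c),
      ∃ E : Fin r → Matrix (Fin n) (Fin n) ℂ,
        (∑ σ : Equiv.Perm (Fin n), MvPolynomial.C (β n σ) *
            ∏ i : Fin n, (MvPolynomial.X (σ i, i) : MvPolynomial (Fin n × Fin n) ℂ)) =
          ∑ t, (Matrix.of fun i j => MvPolynomial.C (E t i j) * MvPolynomial.X (i, j)).det

/-- The sanity direction: the crux is the class-function case of `UnrestrictedFNF`. -/
theorem fermionicNormalForm_of_unrestricted (h : UnrestrictedFNF) : FermionicNormalForm :=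
  fun χ _ hP => h χ hP

/-- The relabelling `Fin n ≃ Fin (n/3 · 3)` for `3 ∣ n`. -/
def blockCast {n : ℕ} (h : 3 ∣ n) : Fin n ≃ Fin (n / 3 * 3) :=
  finCongr (Nat.div_mul_cancel h).symm

/-- The witness coefficient family: the block indicator (transported to `Fin n`) when `3 ∣ n`, the
indicator of the identity otherwise. -/
def witnessCoeff (n : ℕ) (σ : Perm (Fin n)) : ℂ :=
  if h : 3 ∣ n then blockCoeff (n / 3) ((blockCast h).permCongr σ) else if σ = 1 then 1 else 0

/-- The witness family in closed form when `3 ∤ n`: the diagonal monomial. -/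
theorem gmf_witness_of_not_dvd {n : ℕ} (h : ¬ 3 ∣ n) :
    (∑ σ : Perm (Fin n), C (witnessCoeff n σ) *
        ∏ i : Fin n, (X (σ i, i) : MvPolynomial (Fin n × Fin n) ℂ)) =
      ∏ i : Fin n, (X (i, i) : MvPolynomial (Fin n × Fin n) ℂ) := by
  have hw : ∀ σ : Perm (Fin n), witnessCoeff n σ = if σ = 1 then 1 else 0 := fun σ => by
    unfold witnessCoeff; rw [dif_neg h]
  simp_rw [hw]
  rw [Finset.sum_eq_single (1 : Perm (Fin n))]
  · simp
  · intro σ _ hσ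
    rw [if_neg hσ]; simp
  · intro h1; exact absurd (Finset.mem_univ _) h1

/-- The witness family when `3 ∣ n`: the block family transported along `blockCast`. -/
theorem rename_gmf_witness_of_dvd {n : ℕ} (h : 3 ∣ n) :
    rename (Prod.map (blockCast h) (blockCast h))
        (∑ σ : Perm (Fin n), C (witnessCoeff n σ) *
          ∏ i : Fin n, (X (σ i, i) : MvPolynomial (Fin n × Fin n) ℂ)) =
      ∑ σ' : Perm (Fin (n / 3 * 3)), C (blockCoeff (n / 3) σ') *
        ∏ j : Fin (n / 3 * 3), (X (σ' j, j) : MvPolynomial (Fin (n / 3 * 3) × Fin (n / 3 * 3)) ℂ) := by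
  have hw : ∀ σ : Perm (Fin n), witnessCoeff n σ = blockCoeff (n / 3) ((blockCast h).permCongr σ) :=
    fun σ => by unfold witnessCoeff; rw [dif_pos h]
  simp_rw [hw]
  exact rename_gmf (blockCast h) (blockCoeff (n / 3))

/-- **The witness family is p-computable**: complexity `≤ 9 n` (`25·(n/3) ≤ 9n` for the block
product, transported by an injective renaming; `n` diagonal variables otherwise). [folklore] -/
theorem complexity_witness_le (n : ℕ) :
    complexity (∑ σ : Perm (Fin n), C (witnessCoeff n σ) *
        ∏ i : Fin n, (X (σ i, i) : MvPolynomial (Fin n × Fin n) ℂ)) ≤ 9 * n := by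
  by_cases h : 3 ∣ n
  · -- pull back along the relabelling: `f_n = rename (e.symm × e.symm) (block family)`
    set e := blockCast h with he
    have hback : (∑ σ : Perm (Fin n), C (witnessCoeff n σ) *
          ∏ i : Fin n, (X (σ i, i) : MvPolynomial (Fin n × Fin n) ℂ)) =
        rename (Prod.map e.symm e.symm) (∑ σ' : Perm (Fin (n / 3 * 3)), C (blockCoeff (n / 3) σ') *
          ∏ j : Fin (n / 3 * 3), (X (σ' j, j) : MvPolynomial (Fin (n / 3 * 3) × Fin (n / 3 * 3)) ℂ)) := by
      rw [← rename_gmf_witness_of_dvd h, rename_rename]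
      have : (Prod.map e.symm e.symm ∘ Prod.map e e : Fin n × Fin n → Fin n × Fin n) = id := by
        funext ⟨a, b⟩; simp
      rw [this, rename_id, AlgHom.id_apply]
    rw [hback]
    refine (complexity_rename_le_holds' _ _).trans ?_
    rw [gmf_blockCoeff_eq_prod]
    refine (complexity_blockProd_le (n / 3)).trans ?_
    omega
  · rw [gmf_witness_of_not_dvd h]
    refine (complexity_finset_prod_le _ _).trans ?_
    have hX : ∀ x : Fin n × Fin n, complexity (X x : MvPolynomial (Fin n × Fin n) ℂ) = 0 :=
      complexity_X_holds
    simp only [hX, Finset.sum_const_zero, zero_add, Finset.card_univ, Fintype.card_fin]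
    omega

theorem isPComputable_witness :
    IsPComputable (fun n => ∑ σ : Perm (Fin n), C (witnessCoeff n σ) *
      ∏ i : Fin n, (X (σ i, i) : MvPolynomial (Fin n × Fin n) ℂ)) := by
  refine ⟨9, fun n => (complexity_witness_le n).trans ?_⟩
  rcases n with _ | _ | n
  · simp
  · simp
  · have h2 : 2 ^ 8 ≤ (n + 2) ^ 8 := Nat.pow_le_pow_left (by omega) 8
    calc 9 * (n + 2) ≤ (n + 2) ^ 8 * (n + 2) := by nlinarith
      _ = (n + 2) ^ 9 := by ring
      _ ≤ (n + 2) ^ 9 + 9 := Nat.le_add_right _ _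

/-- **X2 WITHOUT THE CLASS-FUNCTION HYPOTHESIS IS FALSE** (`_false_without_classFunction`): the
p-computable block family has `tdr(f_{3m}) ≥ (3/2)^m` (`block_lower_bound` after transport along
`blockCast`), which beats every quasi-polynomial bound (`stub_expBeatsQP`, `tdrPerNotQP_qp_transfer`).
[this census, from landed lemmas] -/
theorem unrestrictedFNF_false : ¬ UnrestrictedFNF := by
  intro hU
  obtain ⟨c, hc⟩ := hU witnessCoeff isPComputable_witness
  obtain ⟨m, hm⟩ := stub_expBeatsQP (c + 3 + 1)
  have hm1 : 1 ≤ m := by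
    rcases Nat.eq_zero_or_pos m with rfl | hpos
    · simp at hm
    · exact hpos
  have hdvd : 3 ∣ m * 3 := dvd_mul_left 3 m
  obtain ⟨r, hr, E, hE⟩ := hc (m * 3) (by omega)
  -- transport the representation along `blockCast : Fin (m*3) ≃ Fin ((m*3)/3*3)`
  have h' := congrArg (rename (Prod.map (blockCast hdvd) (blockCast hdvd))) hE
  rw [rename_gmf_witness_of_dvd hdvd, map_sum] at h'
  simp only [rename_twistedDet] at h'
  have hlb := block_lower_bound (m * 3 / 3) r _ h'
  rw [Nat.mul_div_cancel m (by norm_num : 0 < 3)] at hlb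
  -- the quasi-polynomial bound loses
  have h2 : r * 2 ^ m ≤ 2 ^ ((Nat.log 2 m + (c + 3 + 1)) ^ (c + 3 + 1)) * 2 ^ m :=
    Nat.mul_le_mul_right _ (hr.trans (tdrPerNotQP_qp_transfer m 3 c))
  omega

end Summit.ValiantsHypothesis.ValiantsHypothesis.Cruxes.FermionicNormalForm.StrategistStrengthen
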